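import Mathlib.Combinatorics.SimpleGraph.Paths
import Mathlib.Combinatorics.SimpleGraph.DeleteEdges
import Mathlib.Data.Fintype.Card
import Mathlib.Data.Set.Card
import Literature.Combinatorics.SimpleGraph.MengerTwo
import Literature.Combinatorics.SimpleGraph.WalkSplice
import HarnessLib

/-!
# Menger's theorem (set form): separators and systems of disjoint `A`–`B` paths

Topic `Literature/Combinatorics/SimpleGraph`. This file sets up the objects of **Menger's theorem
in its original set form** (K. Menger 1927; Diestel, *Graph Theory*, Thm. 3.3.1; Chartrand–Jordon–
Vatter–Zhang, *Graphs & Digraphs*, 7th ed., Thm. 4.17): for a finite graph `G` and vertex sets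
`A`, `B`, the maximum number of pairwise vertex-disjoint `A`–`B` paths equals the minimum size of
an `A`–`B` separating set. The theorem itself (`exists_abPathSystem_of_forall_separator`, by
Göring's short inductive proof, as in Chartrand et al.) is proved in `MengerTheorem.lean`; the
gluing step lives in `MengerGlue.lean`; the case `k = 2` was treated earlier, by a different
argument, in `MengerTwo.lean`.

## Contents

* `IsVxSeparator G A B S` — `S` meets every walk of `G` from `A` to `B` (an "`A`–`B` separating
  set"; it must contain `A ∩ B`).
* `ABPathSystem G A B ι` — a family, indexed by `ι`, of pairwise vertex-disjoint `A`–`B` PATHS in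
  Diestel's strict sense (the path meets `A` exactly in its first and `B` exactly in its last
  vertex).
* The easy inequality `ABPathSystem.card_le_card_of_isVxSeparator`: a system of `k` disjoint
  `A`–`B` paths forces every separator to have `≥ k` vertices.
* Transport along `G' ≤ G` (`ABPathSystem.mapLe`), re-indexing by the last / first vertices
  (`ABPathSystem.exists_reindex_lst`, `…_fst`), the trivial system on a subset of `A ∩ B`.
* Walk lemmas (splitting a walk at an edge it uses is `exists_append_cons_of_mem_edges` of
  `WalkSplice.lean`): the end
  (start) vertex of a path does not occur in a proper prefix (suffix)
  (`IsPath.eq_of_end_mem_support_takeUntil`, `IsPath.eq_of_start_mem_support_dropUntil`), and the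
  separator lemma behind the induction: an `A`–`B` separator of `G - e`, `e = xy`, together with
  `x` (or with `y`) separates `A` from `B` in `G` (`IsVxSeparator.insert_of_deleteEdges`).

## References

* K. Menger, Zur allgemeinen Kurventheorie, *Fund. Math.* 10 (1927) 96–115.
* F. Göring, Short proof of Menger's theorem, *Discrete Math.* 219 (2000) 295–296.
* R. Diestel, *Graph Theory*, 5th ed., GTM 173 (2017), Thm. 3.3.1 (third proof) [Diestel2017].
* G. Chartrand, H. Jordon, V. Vatter, P. Zhang, *Graphs & Digraphs*, 7th ed., CRC (2024),
  Thm. 4.17 and its proof ("the proof given above follows that of Göring").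
-/

namespace Literature.Combinatorics.SimpleGraph

open _root_.SimpleGraph

universe u

variable {V : Type u} {G : _root_.SimpleGraph V}

/-! ### Separators -/

/-- `S` is an **`A`–`B` separating set** (vertex separator) of `G`: every walk of `G` from a
vertex of `A` to a vertex of `B` has a vertex in `S` (Diestel, §3.3; Chartrand et al. §4.4: "a
set `X ⊆ V(G)` such that there are no `A`–`B` paths in `G - X`"; in particular `A ∩ B ⊆ S`).
[cite: Diestel2017, §3.3 (A–B separator)] -/
def IsVxSeparator (G : _root_.SimpleGraph V) (A B S : Set V) : Prop :=
  ∀ ⦃u v : V⦄, u ∈ A → v ∈ B → ∀ p : G.Walk u v, ∃ z ∈ p.support, z ∈ S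

namespace IsVxSeparator

variable {A B S : Set V}

/-- A separator contains `A ∩ B` (trivial walks). [cite: Diestel2017, §3.3 (A–B separator)] -/
theorem inter_subset (h : IsVxSeparator G A B S) : A ∩ B ⊆ S := by
  intro z hz
  obtain ⟨w, hw, hwS⟩ := h hz.1 hz.2 (Walk.nil : G.Walk z z)
  rw [Walk.support_nil, List.mem_singleton] at hw
  exact hw ▸ hwS

/-- Separators are monotone in the separating set. [cite: Diestel2017, §3.3 (A–B separator)] -/
theorem mono {S' : Set V} (h : IsVxSeparator G A B S) (hS : S ⊆ S') : IsVxSeparator G A B S' :=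
  fun _ _ hu hv p => let ⟨z, hz, hzS⟩ := h hu hv p; ⟨z, hz, hS hzS⟩

/-- A separator of `G` separates in every subgraph `G' ≤ G`. [cite: Diestel2017, §3.3 (A–B separator)] -/
theorem anti {G' : _root_.SimpleGraph V} (h : IsVxSeparator G A B S) (hG : G' ≤ G) :
    IsVxSeparator G' A B S := by
  intro u v hu hv p
  obtain ⟨z, hz, hzS⟩ := h hu hv (p.mapLe hG)
  rw [Walk.support_mapLe_eq_support] at hz
  exact ⟨z, hz, hzS⟩

/-- Symmetry: an `A`–`B` separator is a `B`–`A` separator. [cite: Diestel2017, §3.3 (A–B separator)] -/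
theorem symm (h : IsVxSeparator G A B S) : IsVxSeparator G B A S := by
  intro u v hu hv p
  obtain ⟨z, hz, hzS⟩ := h hv hu p.reverse
  rw [Walk.support_reverse, List.mem_reverse] at hz
  exact ⟨z, hz, hzS⟩

/-- In the edgeless graph `⊥`, `A ∩ B` separates `A` from `B` (every walk is trivial).
[cite: Diestel2017, Thm. 3.3.1 (proof, base case)] -/
theorem bot_inter (A B : Set V) : IsVxSeparator (⊥ : _root_.SimpleGraph V) A B (A ∩ B) := by
  intro u v hu hv p
  cases p with
  | nil => exact ⟨u, by simp, hu, hv⟩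
  | cons h _ => exact absurd h (by simp)

end IsVxSeparator

/-- `A` itself is an `A`–`B` separator. [cite: Diestel2017, §3.3 (A–B separator)] -/
theorem isVxSeparator_left (A B : Set V) : IsVxSeparator G A B A :=
  fun u _ hu _ p => ⟨u, p.start_mem_support, hu⟩

/-! ### Systems of disjoint `A`–`B` paths -/

/-- A **system of pairwise disjoint `A`–`B` paths** of `G` indexed by `ι` (Diestel §3.3: an `A`–`B`
path meets `A` exactly in its first vertex and `B` exactly in its last vertex; "disjoint" =
no common vertex, end vertices included). [cite: Diestel2017, §3.3 (A–B paths)] -/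
structure ABPathSystem (G : _root_.SimpleGraph V) (A B : Set V) (ι : Type u) : Type u where
  /-- first vertex of the `i`-th path -/
  fst : ι → V
  /-- last vertex of the `i`-th path -/
  lst : ι → V
  /-- the `i`-th path, as a walk -/
  walk : ∀ i, G.Walk (fst i) (lst i)
  fst_mem : ∀ i, fst i ∈ A
  lst_mem : ∀ i, lst i ∈ B
  isPath : ∀ i, (walk i).IsPath
  /-- the path meets `A` only in its first vertex -/
  eq_fst_of_mem : ∀ i, ∀ z ∈ (walk i).support, z ∈ A → z = fst i
  /-- the path meets `B` only in its last vertex -/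
  eq_lst_of_mem : ∀ i, ∀ z ∈ (walk i).support, z ∈ B → z = lst i
  /-- distinct paths have no common vertex -/
  disjoint : ∀ i j, i ≠ j → List.Disjoint (walk i).support (walk j).support

namespace ABPathSystem

variable {A B : Set V} {ι : Type u}

/-- Distinct paths of a system have distinct last vertices. [cite: Diestel2017, §3.3 (A–B paths)] -/
theorem lst_injective (P : ABPathSystem G A B ι) : Function.Injective P.lst := by
  intro i j h
  by_contra hij
  exact P.disjoint i j hij (P.walk i).end_mem_support (by rw [h]; exact (P.walk j).end_mem_support)

/-- Distinct paths of a system have distinct first vertices. [cite: Diestel2017, §3.3 (A–B paths)] -/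
theorem fst_injective (P : ABPathSystem G A B ι) : Function.Injective P.fst := by
  intro i j h
  by_contra hij
  exact P.disjoint i j hij (P.walk i).start_mem_support
    (by rw [h]; exact (P.walk j).start_mem_support)

/-- **The easy half of Menger's theorem**: a system of `|ι|` disjoint `A`–`B` paths forces every
finite `A`–`B` separator to have at least `|ι|` vertices (one on each path, pairwise distinct).
[cite: Diestel2017, Thm. 3.3.1 (easy direction)] -/
theorem card_le_card_of_isVxSeparator [Fintype ι] (P : ABPathSystem G A B ι) {S : Finset V}
    (hS : IsVxSeparator G A B ↑S) : Fintype.card ι ≤ S.card := by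
  classical
  choose f hf hfS using fun i => hS (P.fst_mem i) (P.lst_mem i) (P.walk i)
  have hinj : Function.Injective f := by
    intro i j h
    by_contra hij
    exact P.disjoint i j hij (hf i) (h ▸ hf j)
  calc Fintype.card ι ≤ Fintype.card (↑S : Set V) :=
        Fintype.card_le_of_injective (fun i => ⟨f i, hfS i⟩) fun i j h => hinj (by simpa using h)
    _ = S.card := Fintype.card_of_subtype S fun _ => Finset.mem_coe.symm

/-- Transport of a system along `G' ≤ G` (same vertices, same walks).
[cite: Diestel2017, §3.3 (A–B paths)] -/
def mapLe {G' : _root_.SimpleGraph V} (h : G' ≤ G) (P : ABPathSystem G' A B ι) :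
    ABPathSystem G A B ι where
  fst := P.fst
  lst := P.lst
  walk i := (P.walk i).transfer G fun e he => edgeSet_subset_edgeSet.2 h
    ((P.walk i).edges_subset_edgeSet he)
  fst_mem := P.fst_mem
  lst_mem := P.lst_mem
  isPath i := (P.isPath i).transfer _
  eq_fst_of_mem i z hz := P.eq_fst_of_mem i z (by rwa [Walk.support_transfer] at hz)
  eq_lst_of_mem i z hz := P.eq_lst_of_mem i z (by rwa [Walk.support_transfer] at hz)
  disjoint i j hij := by
    rw [Walk.support_transfer, Walk.support_transfer]
    exact P.disjoint i j hij

/-- Re-indexing a system along an equivalence of index types. [cite: Diestel2017, §3.3 (A–B paths)] -/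
def reindex {κ : Type u} (P : ABPathSystem G A B ι) (e : κ ≃ ι) : ABPathSystem G A B κ where
  fst k := P.fst (e k)
  lst k := P.lst (e k)
  walk k := P.walk (e k)
  fst_mem k := P.fst_mem (e k)
  lst_mem k := P.lst_mem (e k)
  isPath k := P.isPath (e k)
  eq_fst_of_mem k := P.eq_fst_of_mem (e k)
  eq_lst_of_mem k := P.eq_lst_of_mem (e k)
  disjoint k l hkl := P.disjoint (e k) (e l) fun h => hkl (e.injective h)

/-- **Re-indexing by last vertices.** If the last vertices of a system of `|T|` disjoint paths lie
in the finset `T`, the system can be indexed by `T` itself, the path indexed by `z` ending at `z`.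
[cite: Diestel2017, §3.3 (A–B paths)] -/
theorem exists_reindex_lst [Fintype ι] (P : ABPathSystem G A B ι) (T : Finset V)
    (hT : ∀ i, P.lst i ∈ T) (hcard : Fintype.card ι = T.card) :
    ∃ P' : ABPathSystem G A B (↑T : Set V), ∀ z, P'.lst z = z := by
  classical
  let f : ι → (↑T : Set V) := fun i => ⟨P.lst i, hT i⟩
  have hinj : Function.Injective f := fun i j h => P.lst_injective (by simpa [f] using h)
  have hcard' : Fintype.card ι = Fintype.card (↑T : Set V) := by
    rw [hcard, Fintype.card_of_subtype T fun _ => Finset.mem_coe.symm]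
  have hbij : Function.Bijective f := (Fintype.bijective_iff_injective_and_card f).2 ⟨hinj, hcard'⟩
  refine ⟨P.reindex (Equiv.ofBijective f hbij).symm, fun z => ?_⟩
  exact congrArg Subtype.val (Equiv.ofBijective_apply_symm_apply f hbij z)

/-- **Re-indexing by first vertices** (symmetric to `exists_reindex_lst`).
[cite: Diestel2017, §3.3 (A–B paths)] -/
theorem exists_reindex_fst [Fintype ι] (P : ABPathSystem G A B ι) (T : Finset V)
    (hT : ∀ i, P.fst i ∈ T) (hcard : Fintype.card ι = T.card) :
    ∃ P' : ABPathSystem G A B (↑T : Set V), ∀ z, P'.fst z = z := by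
  classical
  let f : ι → (↑T : Set V) := fun i => ⟨P.fst i, hT i⟩
  have hinj : Function.Injective f := fun i j h => P.fst_injective (by simpa [f] using h)
  have hcard' : Fintype.card ι = Fintype.card (↑T : Set V) := by
    rw [hcard, Fintype.card_of_subtype T fun _ => Finset.mem_coe.symm]
  have hbij : Function.Bijective f := (Fintype.bijective_iff_injective_and_card f).2 ⟨hinj, hcard'⟩
  refine ⟨P.reindex (Equiv.ofBijective f hbij).symm, fun z => ?_⟩
  exact congrArg Subtype.val (Equiv.ofBijective_apply_symm_apply f hbij z)

/-- **The trivial system**: the one-vertex paths at the vertices of a finset `T ⊆ A ∩ B`.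
[cite: Diestel2017, Thm. 3.3.1 (proof, base case)] -/
def trivial (T : Finset V) (hT : (↑T : Set V) ⊆ A ∩ B) : ABPathSystem G A B (↑T : Set V) where
  fst z := z
  lst z := z
  walk _ := Walk.nil
  fst_mem z := (hT z.2).1
  lst_mem z := (hT z.2).2
  isPath _ := Walk.IsPath.nil
  eq_fst_of_mem z w hw _ := by simpa using hw
  eq_lst_of_mem z w hw _ := by simpa using hw
  disjoint z w hzw := by
    simp only [Walk.support_nil, List.disjoint_singleton, List.mem_singleton]
    exact fun h => hzw (Subtype.ext h.symm)

end ABPathSystem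

/-! ### Walk lemmas -/

/-- In a trail split at an edge, the two outer pieces avoid that edge. [folklore] -/
theorem not_mem_edges_of_isTrail_append_cons {u v a b : V} {q : G.Walk u a} {h : G.Adj a b}
    {r : G.Walk b v} (ht : (q.append (Walk.cons h r)).IsTrail) :
    s(a, b) ∉ q.edges ∧ s(a, b) ∉ r.edges := by
  rw [Walk.isTrail_def, Walk.edges_append, Walk.edges_cons, List.nodup_append] at ht
  obtain ⟨-, hr, hdisj⟩ := ht
  refine ⟨fun hq => hdisj _ hq _ List.mem_cons_self rfl, ?_⟩
  rw [List.nodup_cons] at hr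
  exact hr.1

/-- **The last vertex of a path lies in no proper prefix**: if the end `v` of the path `p` belongs
to `p.takeUntil w`, then `w = v`. [folklore] -/
theorem IsPath.eq_of_end_mem_support_takeUntil [DecidableEq V] {u v w : V} {p : G.Walk u v}
    (hp : p.IsPath) (hw : w ∈ p.support) (hv : v ∈ (p.takeUntil w hw).support) : w = v := by
  by_contra hne
  have hspec := p.take_spec hw
  have hnodup : ((p.takeUntil w hw).append (p.dropUntil w hw)).support.Nodup := by
    rw [hspec]; exact hp.support_nodup
  rw [Walk.support_append, List.nodup_append] at hnodup
  have htail : v ∈ (p.dropUntil w hw).support.tail := by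
    have hq : (p.dropUntil w hw).support = w :: (p.dropUntil w hw).support.tail :=
      ((p.dropUntil w hw).cons_tail_support).symm
    have hmem := (p.dropUntil w hw).end_mem_support
    rw [hq, List.mem_cons] at hmem
    rcases hmem with h | h
    · exact absurd h.symm hne
    · exact h
  exact hnodup.2.2 _ hv _ htail rfl

/-- **The first vertex of a path lies in no proper suffix**: if the start `u` of the path `p`
belongs to `p.dropUntil w`, then `w = u`. [folklore] -/
theorem IsPath.eq_of_start_mem_support_dropUntil [DecidableEq V] {u v w : V} {p : G.Walk u v}
    (hp : p.IsPath) (hw : w ∈ p.support) (hu : u ∈ (p.dropUntil w hw).support) : w = u := by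
  by_contra hne
  have hspec := p.take_spec hw
  have hnodup : ((p.takeUntil w hw).append (p.dropUntil w hw)).support.Nodup := by
    rw [hspec]; exact hp.support_nodup
  rw [Walk.support_append, List.nodup_append] at hnodup
  have htail : u ∈ (p.dropUntil w hw).support.tail := by
    have hq : (p.dropUntil w hw).support = w :: (p.dropUntil w hw).support.tail :=
      ((p.dropUntil w hw).cons_tail_support).symm
    rw [hq, List.mem_cons] at hu
    rcases hu with h | h
    · exact absurd h.symm hne
    · exact h
  exact hnodup.2.2 _ (p.takeUntil w hw).start_mem_support _ htail rfl

/-- Variant of `IsPath.eq_of_end_mem_support_takeUntil` with the end vertex given up to an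
equation (convenient under dependent types). [folklore] -/
theorem IsPath.eq_of_mem_support_takeUntil_of_eq_end [DecidableEq V] {u v w z : V}
    {p : G.Walk u v} (hp : p.IsPath) (hw : w ∈ p.support)
    (hz : z ∈ (p.takeUntil w hw).support) (hzv : z = v) : w = v := by
  subst hzv
  exact IsPath.eq_of_end_mem_support_takeUntil hp hw hz

/-- Variant of `IsPath.eq_of_start_mem_support_dropUntil` with the start vertex given up to an
equation. [folklore] -/
theorem IsPath.eq_of_mem_support_dropUntil_of_eq_start [DecidableEq V] {u v w z : V}
    {p : G.Walk u v} (hp : p.IsPath) (hw : w ∈ p.support)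
    (hz : z ∈ (p.dropUntil w hw).support) (hzu : z = u) : w = u := by
  subst hzu
  exact IsPath.eq_of_start_mem_support_dropUntil hp hw hz

/-- A walk avoiding the edge `e` is a walk of `G - e` with the same vertices. [folklore] -/
theorem exists_walk_deleteEdges_of_not_mem_edges {u v : V} (e : Sym2 V) (p : G.Walk u v)
    (he : e ∉ p.edges) :
    ∃ p' : (G.deleteEdges {e}).Walk u v, p'.support = p.support ∧ (p.IsPath → p'.IsPath) := by
  refine ⟨p.toDeleteEdges {e} fun e' he' h => he (by rw [Set.mem_singleton_iff] at h; exact h ▸ he'),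
    Walk.support_transfer _ _, fun hp => hp.transfer _⟩

/-! ### The separator lemma of the induction step -/

namespace IsVxSeparator

variable {A B : Set V}

/-- **An `A`–`B` separator of `G - xy`, together with `x`, separates `A` from `B` in `G`**: an
`A`–`B` walk of `G` either uses the edge `xy` — and then contains `x` — or is a walk of `G - xy`
(Chartrand et al., proof of Thm. 4.17: "`X ∪ {x}` would be an `A`–`B` separating set of `G`").
[cite: Diestel2017, Thm. 3.3.1 (third proof)] -/
theorem insert_of_deleteEdges {x y : V} {X : Set V}
    (hX : IsVxSeparator (G.deleteEdges {s(x, y)}) A B X) :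
    IsVxSeparator G A B (insert x X) := by
  classical
  intro u v hu hv p
  by_cases he : s(x, y) ∈ p.edges
  · exact ⟨x, p.fst_mem_support_of_mem_edges he, Set.mem_insert _ _⟩
  · obtain ⟨p', hp', -⟩ := exists_walk_deleteEdges_of_not_mem_edges (s(x, y)) p he
    obtain ⟨z, hz, hzX⟩ := hX hu hv p'
    exact ⟨z, hp' ▸ hz, Set.mem_insert_of_mem _ hzX⟩

/-- The same with the other endpoint `y` of the deleted edge.
[cite: Diestel2017, Thm. 3.3.1 (third proof)] -/
theorem insert_of_deleteEdges' {x y : V} {X : Set V}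
    (hX : IsVxSeparator (G.deleteEdges {s(x, y)}) A B X) :
    IsVxSeparator G A B (insert y X) := by
  rw [Sym2.eq_swap] at hX
  exact hX.insert_of_deleteEdges

end IsVxSeparator

end Literature.Combinatorics.SimpleGraph
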